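import Summits.AtomisticToContinuum.Crystallization.Theorems.FrustratedLawDichotomyThirdNeighbour

/-!
# FrustratedLawDichotomy · crux `AperiodicFrustratedLawGap` (stmt-AtomisticToContinuum-27623) — «NO TWIST» FROM THE `√3`-BOUND THROUGH THE
# ABSTRACT THIRD-NEIGHBOUR EXCLUSION (decomp-a2c, prover hand 2, gen 11)

`noTwist_of_pairBound` (p823632) with its numerical lens hypothesis replaced by `ThirdNeighbourExclusion θ D₀`
(`FrustratedLawDichotomyThirdNeighbour`): at a corner `w` of a `Pat`-classified link whose neighbour `τ w` is `Pat'`-classified, the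
correspondence of the four common sites maps `Pat`-diagonal pairs to `Pat'`-diagonal pairs, given `LinkPairBound θ D₀ √3 Pat` and the
exclusion.  The combinatorial body is p823632's verbatim (adapted); only the last step changes — the two further common neighbours
`q (τ w)` (first shell) and `q X` (`X ≠ i`, so `‖q X‖ ≥ 1`) of the `√3`-pair `q (τ a), q (τ c)` are handed to the exclusion with their
coupled windows.  With `thirdNeighbourExclusion_of_lensThree` this is p823632 again; with `thirdNeighbourExclusion_of_centre` the admissible
`D₀` drops from `1.693` to `1.677` at `θ = 1/100`.  `[folklore]`; def-free; no `sorry`; no `instance`/`notation`.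
-/

noncomputable section

namespace Summit.AtomisticToContinuum.Crystallization.Theorems.FrustratedLawDichotomyThirdNeighbourNoTwist

open Literature.Geometry.DiscreteGeometry
open Summit.AtomisticToContinuum.Crystallization.Theorems.FrustratedLawDichotomyTwoShellRigidityCut (E3 LinkIso)
open Summit.AtomisticToContinuum.Crystallization.Theorems.FrustratedLawDichotomyLinkIsoToolkit (injective_of_linkIso)
open Summit.AtomisticToContinuum.Crystallization.Theorems.FrustratedLawDichotomyCornerPairing
  (exists_partner dist_eq_one_iff_of_partners)
open Summit.AtomisticToContinuum.Crystallization.Theorems.FrustratedLawDichotomyBondGraphWindows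
  (dist_le_mul_dist_of_adj min_dist_lt_dist_of_not_adj)
open Summit.AtomisticToContinuum.Crystallization.Theorems.FrustratedLawDichotomyNoTwistCert (BondLike)
open Summit.AtomisticToContinuum.Crystallization.Theorems.FrustratedLawDichotomyHalfCap (exists_halfCap_of_diagonal_partners)
open Summit.AtomisticToContinuum.Crystallization.Theorems.FrustratedLawDichotomyNoTwistSwap (dist_centre_partner_eq_one linkIso_rebase)
open Summit.AtomisticToContinuum.Crystallization.Theorems.FrustratedLawDichotomyNoTwistOfPairBound (LinkPairBound)
open Summit.AtomisticToContinuum.Crystallization.Theorems.FrustratedLawDichotomyThirdNeighbour (ThirdNeighbourExclusion)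

variable {θ : ℝ} {Pat Pat' : Finset E3} {N : ℕ} {y : Fin N → E3} {i : Fin N} {τ : ↥Pat → Fin N} {τ' : ↥Pat' → Fin N}

/-- ★ **NO TWISTED CORNER FROM THE `√3`-BOUND AND THE THIRD-NEIGHBOUR EXCLUSION (abstract corner lemma).**  `LinkIso θ Pat y i τ`, corner
`w`, neighbour `τ w` with a `Pat'`-classified link `τ'`, `τ' w' = i`; `a, b ∈ C(w)` a `Pat`-diagonal pair with partners `a', b'`.
Hypotheses: `LinkPairBound θ D₀ √3 Pat`, `ThirdNeighbourExclusion θ D₀`, and the local pattern facts of p823632.  Conclusion: `{a', b'}` is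
a `Pat'`-diagonal pair. [folklore] -/
theorem noTwist_of_exclusion {D₀ : ℝ}
    (hPat : ∀ u v : ↥Pat, u ≠ v → ∃ c : ↥Pat, dist (u : E3) (c : E3) = 1 ∧ dist (v : E3) (c : E3) ≠ 1)
    (hPat' : ∀ u v : ↥Pat', u ≠ v → ∃ c : ↥Pat', dist (u : E3) (c : E3) = 1 ∧ dist (v : E3) (c : E3) ≠ 1)
    (hB : LinkPairBound θ D₀ (Real.sqrt 3) Pat) (hθ : 0 ≤ θ) (hE : ThirdNeighbourExclusion θ D₀)
    (hy : Function.Injective y) (hL : LinkIso θ Pat y i τ) (w : ↥Pat) (hL' : LinkIso θ Pat' y (τ w) τ')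
    {w' : ↥Pat'} (hw' : τ' w' = i) {a b : ↥Pat} {a' b' : ↥Pat'} (ha : dist (w : E3) (a : E3) = 1)
    (ha' : τ' a' = τ a) (hb' : τ' b' = τ b)
    (hF1 : ∃ c' : ↥Pat', dist (w' : E3) (c' : E3) = 1 ∧ dist (a' : E3) (c' : E3) = Real.sqrt 2)
    (hF2 : ∀ x : ↥Pat, dist (w : E3) (x : E3) = 1 → dist (a : E3) (x : E3) = Real.sqrt 2 → x = b)
    (hS3 : ∀ x : ↥Pat, dist (w : E3) (x : E3) = 1 → a ≠ x → dist (a : E3) (x : E3) ≠ 1 →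
      dist (a : E3) (x : E3) ≠ Real.sqrt 2 → dist (a : E3) (x : E3) = Real.sqrt 3)
    (h2' : ∀ u' v' : ↥Pat', dist (u' : E3) (v' : E3) = Real.sqrt 2 →
      ({c : ↥Pat' | dist (u' : E3) (c : E3) = 1} ∩ {c : ↥Pat' | dist (v' : E3) (c : E3) = 1}).ncard = 2)
    (hna' : ∀ u' v' c c' : ↥Pat', dist (u' : E3) (v' : E3) = Real.sqrt 2 → dist (u' : E3) (c : E3) = 1 → dist (v' : E3) (c : E3) = 1 →
      dist (u' : E3) (c' : E3) = 1 → dist (v' : E3) (c' : E3) = 1 → c ≠ c' → dist (c : E3) (c' : E3) ≠ 1) :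
    dist (a' : E3) (b' : E3) = Real.sqrt 2 := by
  classical
  by_contra hne
  have hτ : Function.Injective τ := injective_of_linkIso hPat hL
  have hτ' : Function.Injective τ' := injective_of_linkIso hPat' hL'
  have hLw : LinkIso θ Pat y (τ' w') τ := linkIso_rebase hL hw'
  have hw'a' : dist (w' : E3) (a' : E3) = 1 := dist_centre_partner_eq_one hL w hL' hw' ha'
  -- the diagonal partner c' of a' inside C'(w') and its partner c ∈ C(w)
  obtain ⟨c', hc'w, hac'⟩ := hF1
  have hc'b' : c' ≠ b' := fun h => hne (by rw [← h]; exact hac')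
  obtain ⟨c, hcw, hc, -⟩ := exists_partner hτ hL' w' hLw (w' := w) rfl hc'w
  -- {a, c} is a √3-pair of C(w)
  have hsqrt2_ne_one : Real.sqrt 2 ≠ 1 := by
    intro h
    have := Real.sqrt_eq_one.1 h
    norm_num at this
  have hca : a ≠ c := by
    intro h
    have : c' = a' := hτ' (by rw [← hc, ← h, ha'])
    rw [this, dist_self] at hac'
    exact (Real.sqrt_pos.2 (by norm_num : (0 : ℝ) < 2)).ne hac'
  have hcb : c ≠ b := by
    intro h
    exact hc'b' (hτ' (by rw [← hc, h, hb']))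
  have hac1 : dist (a : E3) (c : E3) ≠ 1 := by
    intro h
    have := (dist_eq_one_iff_of_partners hL w hL' ha' hc.symm).1 h
    rw [hac'] at this
    exact hsqrt2_ne_one this
  have hac2 : dist (a : E3) (c : E3) ≠ Real.sqrt 2 := fun h => hcb (hF2 c hcw h)
  have hac3 : dist (a : E3) (c : E3) = Real.sqrt 3 := hS3 c hcw hca hac1 hac2
  -- the third common neighbour X of τ a, τ c
  obtain ⟨X, hXi, hXa, hXc, hXw, hXr⟩ := exists_halfCap_of_diagonal_partners hτ' hL w hL' hw' hw'a' hc'w ha' hc.symm hac'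
    (h2' a' c' hac') (fun d d' h1 h2 h3 h4 hne' => hna' a' c' d d' hac' h1 h2 h3 h4 hne')
  -- rescale about y i with unit nearestDist y i
  have hθpos : 0 < 1 + θ := by linarith
  set r : ℝ := nearestDist y i with hr_def
  have hwi : τ w ≠ i := fun h => (hL.1 w).ne h.symm
  have hr0 : 0 < r := by
    obtain ⟨k₀, hk₀, hr⟩ := exists_nearestDist_eq_dist y (j := i) ⟨τ w, hwi⟩
    rw [hr_def, hr]
    exact dist_pos.2 fun h => hk₀ (hy h).symm
  have hri : 0 < r⁻¹ := inv_pos.2 hr0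
  set q : Fin N → E3 := fun j => r⁻¹ • (y j - y i) with hq_def
  have hq_sub : ∀ j l, ‖q j - q l‖ = r⁻¹ * dist (y j) (y l) := by
    intro j l
    simp only [hq_def]
    rw [← smul_sub, sub_sub_sub_cancel_right, norm_smul, Real.norm_of_nonneg hri.le, dist_eq_norm]
  have hqi : q i = 0 := by simp [hq_def]
  have hq_norm : ∀ j, ‖q j‖ = r⁻¹ * dist (y j) (y i) := by
    intro j
    have := hq_sub j i
    rwa [hqi, sub_zero] at this
  have hq_inj : Function.Injective q := by
    intro j l h
    have h0 : ‖q j - q l‖ = 0 := by rw [h, sub_self, norm_zero]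
    rw [hq_sub] at h0
    rcases mul_eq_zero.1 h0 with h1 | h1
    · exact absurd h1 hri.ne'
    · exact hy (dist_eq_zero.1 h1)
  have sA : ∀ j, j ≠ i → 1 ≤ ‖q j‖ := by
    intro j hj
    rw [hq_norm, dist_comm]
    have := nearestDist_le_dist y hj
    rw [← hr_def] at this
    calc (1 : ℝ) = r⁻¹ * r := by field_simp
      _ ≤ r⁻¹ * dist (y i) (y j) := mul_le_mul_of_nonneg_left this hri.le
  have sR : ∀ j, (bondGraph θ y).Adj i j → ‖q j‖ ≤ 1 + θ := by
    intro j hj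
    rw [hq_norm, dist_comm]
    have h1 : dist (y i) (y j) ≤ (1 + θ) * r := dist_le_of_adj hθpos.le hj
    calc r⁻¹ * dist (y i) (y j) ≤ r⁻¹ * ((1 + θ) * r) := mul_le_mul_of_nonneg_left h1 hri.le
      _ = 1 + θ := by field_simp
  have sB : ∀ j k l, (bondGraph θ y).Adj j k → l ≠ j → ‖q j - q k‖ ≤ (1 + θ) * ‖q j - q l‖ := by
    intro j k l hjk hlj
    rw [hq_sub, hq_sub]
    calc r⁻¹ * dist (y j) (y k) ≤ r⁻¹ * ((1 + θ) * dist (y j) (y l)) :=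
          mul_le_mul_of_nonneg_left (dist_le_mul_dist_of_adj hθpos.le hjk hlj) hri.le
      _ = (1 + θ) * (r⁻¹ * dist (y j) (y l)) := by ring
  have sB' : ∀ j k l, (bondGraph θ y).Adj j k → l ≠ k → ‖q j - q k‖ ≤ (1 + θ) * ‖q k - q l‖ := by
    intro j k l hjk hlk
    rw [norm_sub_rev (q j)]
    exact sB k j l hjk.symm hlk
  have sN : ∀ j k j' k', j ≠ k → ¬ (bondGraph θ y).Adj j k → (bondGraph θ y).Adj j j' → (bondGraph θ y).Adj k k' →
      min ‖q j - q j'‖ ‖q k - q k'‖ < ‖q j - q k‖ := by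
    intro j k j' k' hjk hnot hj hk
    rw [hq_sub, hq_sub, hq_sub, ← mul_min_of_nonneg _ _ hri.le]
    exact mul_lt_mul_of_pos_left (min_dist_lt_dist_of_not_adj hθpos.le hjk hnot hj hk) hri
  -- the scalar bound applied to the centre's link
  set p : ↥Pat → E3 := fun u => q (τ u) with hp_def
  have hτi : ∀ u, τ u ≠ i := fun u h => (hL.1 u).ne h.symm
  have hK : ∀ {Z} {j : Fin N}, Z ∈ insert (0 : E3) (Set.range p) → Z ≠ q j → ∃ l, l ≠ j ∧ q l = Z := by
    intro Z j hZ hneq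
    rcases hZ with rfl | ⟨u, rfl⟩
    · exact ⟨i, fun h => hneq (by rw [← h, hqi]), hqi⟩
    · exact ⟨τ u, fun h => hneq (by simp [hp_def, h]), rfl⟩
  have bondLike : ∀ {j k : Fin N}, (bondGraph θ y).Adj j k → BondLike θ (insert 0 (Set.range p)) (q j) (q k) := by
    intro j k hjk
    refine ⟨fun Z hZ hneq => ?_, fun Z hZ hneq => ?_⟩
    · obtain ⟨l, hl, rfl⟩ := hK hZ hneq
      exact sB j k l hjk hl
    · obtain ⟨l, hl, rfl⟩ := hK hZ hneq
      exact sB' j k l hjk hl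
  have hAC : D₀ ≤ dist (q (τ a)) (q (τ c)) := by
    rw [dist_eq_norm]
    refine hB p (fun u => ⟨sA _ (hτi u), sR _ (hL.1 u)⟩) (hq_inj.comp hτ)
      (fun u => by have := bondLike (hL.1 u); rwa [hqi] at this) (fun u v huv => bondLike ((hL.2.2 u v).2 huv))
      (fun u v huv hd => ?_) a c hac3
    have hnot : ¬ (bondGraph θ y).Adj (τ u) (τ v) := fun h => hd ((hL.2.2 u v).1 h)
    have := sN (τ u) (τ v) i i (hτ.ne huv) hnot (hL.1 u).symm (hL.1 v).symm
    simpa [hqi] using this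
  -- adjacency facts
  have hwa_adj : (bondGraph θ y).Adj (τ w) (τ a) := (hL.2.2 w a).2 ha
  have hwc_adj : (bondGraph θ y).Adj (τ w) (τ c) := (hL.2.2 w c).2 hcw
  have hXτa : X ≠ τ a := fun h => hXr ⟨a, h.symm⟩
  have hXτc : X ≠ τ c := fun h => hXr ⟨c, h.symm⟩
  have hXτw : X ≠ τ w := fun h => hXr ⟨w, h.symm⟩
  have hwa_ne : τ w ≠ τ a := hwa_adj.ne
  have hwc_ne : τ w ≠ τ c := hwc_adj.ne
  set lam : ℝ := 1 + θ with hlam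
  have hlam1 : 1 ≤ lam := by rw [hlam]; linarith
  -- window: a neighbour Q of the link point L = q (τ u) (adjacent to i): 1/λ ≤ ‖L − Q‖ ≤ λ²
  have winA : ∀ (u : ↥Pat) (m : Fin N), (bondGraph θ y).Adj (τ u) m → m ≠ τ u →
      lam⁻¹ ^ 2 ≤ dist (q m) (q (τ u)) ^ 2 ∧ dist (q m) (q (τ u)) ^ 2 ≤ (lam ^ 2) ^ 2 := by
    intro u m hadj hm
    have hup : ‖q (τ u) - q m‖ ≤ lam ^ 2 := by
      have h1 := sB (τ u) m i hadj (hτi u).symm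
      rw [hqi, sub_zero] at h1
      nlinarith [sR _ (hL.1 u), sA _ (hτi u)]
    have hlow : lam⁻¹ ≤ ‖q (τ u) - q m‖ := by
      have h1 := sB (τ u) i m (hL.1 u).symm hm
      rw [hqi, sub_zero] at h1
      rw [inv_le_iff_one_le_mul₀ hθpos]
      nlinarith [sA _ (hτi u)]
    rw [dist_eq_norm, norm_sub_rev]
    exact ⟨pow_le_pow_left₀ (inv_nonneg.2 hθpos.le) hlow 2, pow_le_pow_left₀ (norm_nonneg _) hup 2⟩
  -- the two further common neighbours q (τ w), q X of q (τ a), q (τ c): excluded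
  have d12 : lam⁻¹ ≤ dist (q (τ w)) (q X) := by
    have h1 := sB (τ w) i X (hL.1 w).symm hXτw
    rw [hqi, sub_zero] at h1
    rw [dist_eq_norm, inv_le_iff_one_le_mul₀ hθpos]
    nlinarith [sA _ hwi]
  exact hE (q (τ a)) (q (τ c)) (q (τ w)) (q X) hAC (sA _ (hτi a)) (sR _ (hL.1 a)) (sA _ (hτi c)) (sR _ (hL.1 c))
    (winA a (τ w) hwa_adj.symm hwa_ne) (winA c (τ w) hwc_adj.symm hwc_ne) (winA a X hXa.symm hXτa) (winA c X hXc.symm hXτc)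
    (sA _ hwi) (sR _ (hL.1 w)) (sA _ hXi) d12

end Summit.AtomisticToContinuum.Crystallization.Theorems.FrustratedLawDichotomyThirdNeighbourNoTwist

end
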